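import Literature.Computability.Cryptography.QuantumTuringMachinePositionedLocalConditions
import Literature.Computability.Cryptography.QuantumTuringMachinePositionedFaithful
import Literature.Computability.Cryptography.QuantumTuringMachinePositionedOblivious
import Mathlib.LinearAlgebra.UnitaryGroup
import HarnessLib

/-!
# Unidirectional quantum Turing machines in Bernstein–Vazirani's positioned model: the local matrix and the computation window

Toolkit file (no definitions of notions beyond bookkeeping predicates, no named facts) for the
circuit simulation of quantum Turing machines (Yao 1993; Nishimura–Ozawa 2002, Thm. 4.3) in the
positioned model of `QuantumTuringMachinePositioned.lean` (`QTM.PCfg`, `QTM.pevolve`,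
`QTM.pstateAt`, `QTM.PIsWellFormed`).

A machine is *unidirectional* with direction assignment `D : Λ → Dir` if every state `q` is
entered only while moving in direction `D q` (Bernstein–Vazirani 1997, Def. 3.14; the tree's
`QuantumTuringMachineWellFormed.lean` uses the same hypothesis shape `hD`). For such a machine
one step of the time evolution factors through the **local matrix**
`A_D[(q', τ), (p, σ)] = δ(p, σ, q', τ, D q')` on `ℂ^{Q × Σ}` (BV 1997, Thm. 5.3 and the remark
after it: for unidirectional tables well-formedness is exactly "the columns of the local matrix
are orthonormal"): `U |p, T, ξ⟩ = ∑_{q', τ} A_D[(q', τ), (p, T(ξ))] |q', T_ξ^τ, ξ ± 1⟩`, the sign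
being that of `D q'` (`pevolve_single_of_unidirectional`); and `A_D` is unitary when the machine
is well formed (`localMat_mem_unitaryGroup`, from `QTM.orthonormal_of_isWellFormed`). This is the
form in which a circuit carries out one step: one fixed unitary on the (state, scanned symbol)
register followed by a move of the head marker determined by the new state (Yao 1993, §5;
Nishimura–Ozawa 2002, proof of Thm. 4.3, where the general — not necessarily unidirectional —
table is handled by the marked three-cell gate `G₁`; Bernstein–Vazirani 1997, Lemma 5.5, reduces
every machine to a unidirectional one with slowdown `5`).

The second part records the **computation window**: after `s` steps on an input of length `n`
every configuration with non-zero amplitude has its head in `[-s, s]` and all its non-blank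
cells in `[-s, n + s)` (`support_pstateAt_inWindow`), so that `t` steps are faithfully
represented on the finite window `[-t, t + n]` of `2t + n + 1` cells (Nishimura–Ozawa 2002,
proof of Thm. 4.3: "the wires … represent the symbol in the `(j - t)`-th cell", `j ∈ [0, 2t]`;
the extra `n` cells hold the input, which the tree's `QTM.init` writes to the right of the start
cell), together with the cell contents of the initial configuration (`cells_pinit_ofNat`,
`cells_pinit_negSucc`) and of a step target (`cells_pupdTarget`).

## References

* E. Bernstein, U. Vazirani, *Quantum complexity theory*, SIAM J. Comput. 26 (1997) 1411–1473
  [BernsteinVaziraniSICOMP1997]: Def. 3.2 (time evolution), Def. 3.14 (unidirectional),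
  Thm. 5.3 and the remark following it (p. 1434), Lemma 5.5 (unidirection lemma).
* H. Nishimura, M. Ozawa, *Computational complexity of uniform quantum circuit families and
  quantum Turing machines*, Theoret. Comput. Sci. 276 (2002) 147–181 = arXiv:quant-ph/9906095
  [NishimuraOzawa2002]: §2 (configurations `(q, T, ξ)`), Thm. 4.3 and its proof.
* A. C.-C. Yao, *Quantum circuit complexity*, Proc. 34th FOCS (1993) 352–361 [YaoFOCS1993].
-/

noncomputable section

namespace Literature.Computability.Cryptography

namespace QTM

open Turing Finsupp Matrix
open scoped BigOperators ComplexConjugate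

variable (M : QTM)

/-! ### Unidirectional tables and the local matrix -/

/-- `M` is **unidirectional with direction assignment `D`**: a transition entering state `q`
while moving in a direction other than `D q` has amplitude `0` (Bernstein–Vazirani 1997,
Def. 3.14: "each state can be entered from only one direction"). [cite: BernsteinVaziraniSICOMP1997, Def. 3.14] -/
def IsUnidirectionalWith (M : QTM) (D : M.Λ → Dir) : Prop :=
  ∀ (p : M.Λ) (a : M.Γ) (q : M.Λ) (b : M.Γ) (d : Dir), d ≠ D q → M.δ p a q b d = 0

/-- The **local matrix** of a table with direction assignment `D`: rows indexed by the new pair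
(state entered, symbol written), columns by the old pair (state, scanned symbol),
`A_D[(q', τ), (p, σ)] = δ(p, σ, q', τ, D q')` (Bernstein–Vazirani 1997, Thm. 5.3 and the remark
after it; Nishimura–Ozawa 2002, proof of Thm. 4.3, the gate `G₁` restricted to one head
position). [cite: BernsteinVaziraniSICOMP1997, Thm. 5.3] -/
def localMat (M : QTM) (D : M.Λ → Dir) : Matrix (M.Λ × M.Γ) (M.Λ × M.Γ) ℂ :=
  Matrix.of fun y x => M.δ x.1 x.2 y.1 y.2 (D y.1)

variable {M}

/-- Entries of the local matrix (definitional). [folklore] -/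
@[simp] theorem localMat_apply (D : M.Λ → Dir) (y x : M.Λ × M.Γ) :
    M.localMat D y x = M.δ x.1 x.2 y.1 y.2 (D y.1) := rfl

/-- Every entry of the local matrix is a transition amplitude of `M`. [folklore] -/
theorem localMat_apply_mem_amplitudes (D : M.Λ → Dir) (y x : M.Λ × M.Γ) :
    M.localMat D y x ∈ M.amplitudes :=
  ⟨x.1, x.2, y.1, y.2, D y.1, rfl⟩

/-- **The local matrix of a well-formed unidirectional machine is unitary** (Bernstein–Vazirani
1997, Thm. 5.3 with the remark following it: for a unidirectional table, well-formedness is the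
orthonormality of the columns `δ(p, σ)`; a square matrix with orthonormal columns is unitary).
Tree model. [cite: BernsteinVaziraniSICOMP1997, Thm. 5.3] -/
theorem localMat_mem_unitaryGroup {D : M.Λ → Dir} (hD : M.IsUnidirectionalWith D)
    (hwf : M.IsWellFormed) : M.localMat D ∈ Matrix.unitaryGroup (M.Λ × M.Γ) ℂ := by
  classical
  obtain ⟨hunit, horth⟩ := M.orthonormal_of_isWellFormed D hD hwf
  rw [Matrix.mem_unitaryGroup_iff']
  ext i j
  rw [Matrix.mul_apply, Matrix.one_apply]
  simp only [Matrix.star_eq_conjTranspose, Matrix.conjTranspose_apply, localMat_apply,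
    RCLike.star_def]
  split_ifs with hij
  · subst hij
    have h : (∑ y : M.Λ × M.Γ, conj (M.δ i.1 i.2 y.1 y.2 (D y.1)) * M.δ i.1 i.2 y.1 y.2 (D y.1)) =
        ((∑ y : M.Λ × M.Γ, ‖M.δ i.1 i.2 y.1 y.2 (D y.1)‖ ^ 2 : ℝ) : ℂ) := by
      rw [Complex.ofReal_sum]
      exact Finset.sum_congr rfl fun y _ => by rw [Complex.conj_mul', Complex.ofReal_pow]
    rw [h, hunit i.1 i.2, Complex.ofReal_one]
  · exact horth i.1 i.2 j.1 j.2 fun h => hij (Prod.ext (Prod.mk.inj h).1 (Prod.mk.inj h).2)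

/-- The local matrix of a unidirectional machine that is well formed in Bernstein–Vazirani's
positioned sense is unitary. [cite: BernsteinVaziraniSICOMP1997, Thm. 5.3] -/
theorem localMat_mem_unitaryGroup_of_pIsWellFormed {D : M.Λ → Dir}
    (hD : M.IsUnidirectionalWith D) (hwf : M.PIsWellFormed) :
    M.localMat D ∈ Matrix.unitaryGroup (M.Λ × M.Γ) ℂ :=
  localMat_mem_unitaryGroup hD (M.isWellFormed_of_pIsWellFormed hwf)

/-- `boolOfDir` is a left inverse of `dirOfBool`. [folklore] -/
@[simp] theorem boolOfDir_dirOfBool (b : Bool) : boolOfDir (dirOfBool b) = b := by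
  cases b <;> rfl

/-- In a unidirectional machine the update triples moving against the direction assignment of
their new state have amplitude zero. [cite: BernsteinVaziraniSICOMP1997, Def. 3.14] -/
theorem updAmp_eq_zero_of_ne {D : M.Λ → Dir} (hD : M.IsUnidirectionalWith D) (c : M.Cfg)
    (u : M.Upd) (h : dirOfBool u.1 ≠ D u.2.1) : M.updAmp c u = 0 :=
  hD _ _ _ _ _ h

/-- **One step of a unidirectional machine through its local matrix** (positioned model):
`U |p, T, ξ⟩ = ∑_{(q', τ)} A_D[(q', τ), (p, T(ξ))] |q', T_ξ^τ, ξ + s(D q')⟩`, `s(L) = -1`,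
`s(R) = +1` (Bernstein–Vazirani 1997, Def. 3.2 with Def. 3.14; Nishimura–Ozawa 2002, §2 and the
proof of Thm. 4.3). [cite: NishimuraOzawa2002, Thm. 4.3 (proof)] -/
theorem pevolve_single_of_unidirectional {D : M.Λ → Dir} (hD : M.IsUnidirectionalWith D)
    (c : M.PCfg) (a : ℂ) :
    M.pevolve (Finsupp.single c a) = ∑ y : M.Λ × M.Γ,
      (a * M.localMat D y (c.1.q, c.1.tape.head)) •
        Finsupp.single (M.pupdTarget c (boolOfDir (D y.1), y)) (1 : ℂ) := by
  rw [M.pevolve_single_eq_sum, Fintype.sum_prod_type, Finset.sum_comm]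
  refine Finset.sum_congr rfl fun y _ => ?_
  rw [Fintype.sum_eq_single (boolOfDir (D y.1))]
  · simp [updAmp, localMat_apply]
  · intro e he
    have hne : dirOfBool e ≠ D y.1 := fun h => he (by rw [← h, boolOfDir_dirOfBool])
    rw [updAmp_eq_zero_of_ne hD c.1 (e, y) hne, mul_zero, zero_smul]

/-- The same with the standard basis vector `|c⟩`. [cite: NishimuraOzawa2002, Thm. 4.3 (proof)] -/
theorem pevolve_single_one_of_unidirectional {D : M.Λ → Dir} (hD : M.IsUnidirectionalWith D)
    (c : M.PCfg) :
    M.pevolve (Finsupp.single c 1) = ∑ y : M.Λ × M.Γ,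
      M.localMat D y (c.1.q, c.1.tape.head) •
        Finsupp.single (M.pupdTarget c (boolOfDir (D y.1), y)) (1 : ℂ) := by
  rw [pevolve_single_of_unidirectional hD]
  simp only [one_mul]

/-! ### Cells of the initial configuration and of step targets -/

/-- The cells of a step target: the scanned cell is rewritten, nothing else
(Nishimura–Ozawa 2002, §2, `T ↦ T_ξ^τ`). [cite: NishimuraOzawa2002, §2] -/
theorem cells_pupdTarget (c : M.PCfg) (u : M.Upd) :
    PCfg.cells (M.pupdTarget c u) = Function.update (PCfg.cells c) c.2 u.2.2 := by
  obtain ⟨e, q', b⟩ := u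
  cases e
  · have h := PCfg.cells_step_left c q' b
    rw [sub_eq_add_neg] at h
    exact h
  · exact PCfg.cells_step_right c q' b

/-- The head position of a step target: `ξ ∓ 1`. [cite: BernsteinVaziraniSICOMP1997, Def. 3.2] -/
@[simp] theorem snd_pupdTarget (c : M.PCfg) (u : M.Upd) :
    (M.pupdTarget c u).2 = c.2 + shiftOfBool u.1 := rfl

/-- The control state of a step target. [cite: BernsteinVaziraniSICOMP1997, Def. 3.2] -/
@[simp] theorem q_pupdTarget (c : M.PCfg) (u : M.Upd) : (M.pupdTarget c u).1.q = u.2.1 := rfl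

/-- The head position of the initial configuration is `0`. [cite: BernsteinVaziraniSICOMP1997, Def. 3.2] -/
@[simp] theorem snd_pinit (x : List Bool) : (M.pinit x).2 = 0 := rfl

/-- The control state of the initial configuration is the start state. [cite: BernsteinVaziraniSICOMP1997, Def. 3.2] -/
@[simp] theorem q_pinit (x : List Bool) : (M.pinit x).1.q = M.start := rfl

/-- The cells of the initial configuration at non-negative indices: the input, embedded in the
tape alphabet, written from the start cell `0` to the right, blanks beyond (the tree's
`QTM.init` = Mathlib's `Tape.mk₁`). [cite: BernsteinVaziraniSICOMP1997, Def. 3.2] -/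
theorem cells_pinit_ofNat (x : List Bool) (k : ℕ) :
    PCfg.cells (M.pinit x) (k : ℤ) = (x.map M.embed).getI k := by
  show (Tape.mk₁ (x.map M.embed)).nth ((k : ℤ) - 0) = _
  rw [sub_zero, Tape.mk₁, Tape.mk₂, Tape.mk'_nth_nat, ListBlank.nth_mk]

/-- Within the input, cell `k` of the initial configuration holds the embedded `k`-th input bit. [cite: BernsteinVaziraniSICOMP1997, Def. 3.2] -/
theorem cells_pinit_of_lt (x : List Bool) {k : ℕ} (hk : k < x.length) :
    PCfg.cells (M.pinit x) (k : ℤ) = M.embed (x[k]) := by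
  rw [cells_pinit_ofNat, List.getI_eq_getElem _ (by simpa using hk), List.getElem_map]

/-- Beyond the input, the cells of the initial configuration at non-negative indices are blank. [cite: BernsteinVaziraniSICOMP1997, Def. 3.2] -/
theorem cells_pinit_of_le (x : List Bool) {k : ℕ} (hk : x.length ≤ k) :
    PCfg.cells (M.pinit x) (k : ℤ) = default := by
  rw [cells_pinit_ofNat, List.getI_eq_default _ (by simpa using hk)]

/-- The cells of the initial configuration at negative indices are blank. [cite: BernsteinVaziraniSICOMP1997, Def. 3.2] -/
theorem cells_pinit_negSucc (x : List Bool) (k : ℕ) :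
    PCfg.cells (M.pinit x) (Int.negSucc k) = default := by
  show (Tape.mk₁ (x.map M.embed)).nth (Int.negSucc k - 0) = _
  rw [sub_zero, Tape.mk₁, Tape.mk₂]
  show (ListBlank.mk ([] : List M.Γ)).nth k = default
  rw [ListBlank.nth_mk, List.getI_nil]

/-! ### The computation window -/

/-- **Window predicate.** After `s` steps on an input of length `n`: the head is in `[-s, s]`
and every cell outside `[-s, n + s)` is blank. [cite: NishimuraOzawa2002, Thm. 4.3 (proof)] -/
def PCfg.InWindow (n s : ℕ) (c : M.PCfg) : Prop :=
  -(s : ℤ) ≤ c.2 ∧ c.2 ≤ s ∧ ∀ z : ℤ, z < -(s : ℤ) ∨ (n : ℤ) + s ≤ z → PCfg.cells c z = default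

/-- The initial configuration is in the window of step `0`. [cite: NishimuraOzawa2002, Thm. 4.3 (proof)] -/
theorem inWindow_pinit (x : List Bool) : PCfg.InWindow x.length 0 (M.pinit x) := by
  refine ⟨by simp, by simp, fun z hz => ?_⟩
  cases z with
  | ofNat k =>
    have hk : x.length ≤ k := by
      simp only [Int.ofNat_eq_natCast] at hz
      omega
    exact cells_pinit_of_le x hk
  | negSucc k => exact cells_pinit_negSucc x k

/-- The windows grow with the number of steps. [folklore] -/
theorem PCfg.InWindow.mono {n s s' : ℕ} {c : M.PCfg} (h : PCfg.InWindow n s c) (hs : s ≤ s') :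
    PCfg.InWindow n s' c := by
  obtain ⟨h₁, h₂, h₃⟩ := h
  refine ⟨by omega, by omega, fun z hz => h₃ z ?_⟩
  omega

/-- **One step stays in the next window**: the head moves by `∓1` and only the scanned cell,
which lies in `[-s, s]`, is rewritten. [cite: NishimuraOzawa2002, Thm. 4.3 (proof)] -/
theorem PCfg.InWindow.pupdTarget {n s : ℕ} {c : M.PCfg} (h : PCfg.InWindow n s c) (u : M.Upd) :
    PCfg.InWindow n (s + 1) (M.pupdTarget c u) := by
  obtain ⟨h₁, h₂, h₃⟩ := h
  refine ⟨?_, ?_, fun z hz => ?_⟩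
  · rw [snd_pupdTarget]; cases u.1 <;> simp <;> omega
  · rw [snd_pupdTarget]; cases u.1 <;> simp <;> omega
  · rw [cells_pupdTarget, Function.update_of_ne]
    · exact h₃ z (by push_cast at hz; omega)
    · push_cast at hz; omega

/-- **The support of the evolved state stays in the windows**: every configuration with
non-zero amplitude after `t` steps on input `x` has its head in `[-t, t]` and its non-blank
cells in `[-t, |x| + t)` (locality of the time evolution, Bernstein–Vazirani 1997, Def. 3.2; the
finite array of `2t + 1` cells of Nishimura–Ozawa's circuit, proof of Thm. 4.3, enlarged by the
input cells). [cite: NishimuraOzawa2002, Thm. 4.3 (proof)] -/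
theorem support_pstateAt_inWindow (x : List Bool) (t : ℕ) :
    ∀ c ∈ (M.pstateAt x t).support, PCfg.InWindow x.length t c := by
  induction t with
  | zero =>
    intro c hc
    have h := Finsupp.support_single_subset hc
    rw [Finset.mem_singleton] at h
    subst h
    exact inWindow_pinit x
  | succ t ih =>
    intro c' hc'
    rw [pstateAt_succ] at hc'
    obtain ⟨c, hc, q, b, h⟩ := M.exists_of_mem_support_pevolveWith M.δ _ c' hc'
    have hw := (ih c hc).pupdTarget
    rcases h with ⟨-, rfl⟩ | ⟨-, rfl⟩
    · have := hw (false, q, b)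
      rwa [show M.pupdTarget c (false, q, b) =
        (((⟨q, (c.1.tape.write b).move Dir.left⟩ : M.Cfg), c.2 - 1) : M.PCfg) from by
          rw [sub_eq_add_neg]; rfl] at this
    · exact hw (true, q, b)

/-- Inside the window the configurations are determined by (state, head position, the cells of
the window): two configurations of `InWindow n s` with the same state, the same head position
and the same cells on `[-s, n + s)` are equal. [cite: BernsteinVaziraniSICOMP1997, Def. 3.1–3.2] -/
theorem PCfg.InWindow.ext {n s : ℕ} {c c' : M.PCfg} (hc : PCfg.InWindow n s c)
    (hc' : PCfg.InWindow n s c') (hq : c.1.q = c'.1.q) (hpos : c.2 = c'.2)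
    (hcells : ∀ z : ℤ, -(s : ℤ) ≤ z → z < (n : ℤ) + s → PCfg.cells c z = PCfg.cells c' z) :
    c = c' := by
  refine PCfg.ext_cells hq hpos (funext fun z => ?_)
  by_cases hz : -(s : ℤ) ≤ z ∧ z < (n : ℤ) + s
  · exact hcells z hz.1 hz.2
  · rw [hc.2.2 z (by omega), hc'.2.2 z (by omega)]

end QTM

end Literature.Computability.Cryptography

end
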